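import Summits.SmoothPoincare4.SmoothPoincare4.Theorems.CylinderEntropyImmortalAreaToFloorNoTwoGoodPoints
import HarnessLib

/-!
# Route `CylinderEntropy`, item `ImmortalAreaToFloor` (stmt-SmoothPoincare4-17197):
# the shadow is injective on the good set (module Γ6/Γ7 of `BLUEPRINT-17197-c2.md`)

For a closed embedded cross-section `f : M⁴ → N = S⁴ × ℝ ⊂ ℝ⁶` with smooth unit normal `ν` tangent
to `N`, the theorem `shadow_injOn_of_good` shows that the shadow `truncL ∘ f : M → S⁴` is INJECTIVE
on any set `G` all of whose points are good up to radius `R₀` (relative smallness of the tilt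
density with threshold `ξ` and of `H²` with threshold `θ`), provided: the height oscillation of `f`
is at most `g_max`, the Willmore energy is at most `W₀`, and the stacking parameters
(`exists_stackingParameters`) together with the Ahlfors growth, the total area bound, the upper
Gaussian density bound and the cutoffs are available — two distinct points of `G` with the same
shadow have different heights (injectivity of `f`), and `noTwoGoodPoints` applies to the lower and
the upper one.

References: W. K. Allard, Ann. of Math. 95 (1972) §6; L. Simon, *Lectures on GMT* (1983) §17.
-/

-- the prescribed namespace `Summit.SmoothPoincare4.SmoothPoincare4.…` repeats `SmoothPoincare4`
set_option linter.dupNamespace false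

noncomputable section

open Bundle Set Function Filter MeasureTheory Module
open scoped Manifold ContDiff Topology RealInnerProductSpace BigOperators

namespace Summit.SmoothPoincare4.SmoothPoincare4.Cruxes.CylinderRungTwo.KillingFlux

open Literature.Geometry.Riemannian Literature.Geometry.Riemannian.EuclideanHypersurface
open Literature.Geometry.Lorentzian Literature.Geometry.Lorentzian.PseudoRiemannianMetric
open Literature.Geometry.Riemannian.SphericalCylinderEntropy (truncL truncL_apply)

variable {M : Type} [TopologicalSpace M] [ChartedSpace (EuclideanSpace ℝ (Fin 4)) M]
  [IsManifold (𝓡 4) ∞ M] [CompactSpace M] [T2Space M] [MeasurableSpace M] [BorelSpace M]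

/-- Two points of `ℝ⁶` with the same shadow and the same height are equal (a private copy of the
tree's `eq_of_truncL_eq_of_apply_five_eq` of `…SliceOfConstantHeight`, to keep the imports light).
[folklore] -/
private theorem eq_of_truncL_eq_of_apply_five_eq' {z z' : EuclideanSpace ℝ (Fin 6)} (h : truncL z = truncL z')
    (h5 : z 5 = z' 5) : z = z' := by
  have h5' : (Fin.last 5 : Fin 6) = 5 := rfl
  ext j
  refine Fin.lastCases ?_ (fun i => ?_) j
  · rw [h5']; exact h5
  · have := congrArg (fun v => v i) h
    simpa [truncL_apply] using this

/-- **The shadow is injective on the good set.**  See the module docstring; `hpar` is the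
parameter package of `exists_stackingParameters` specialised to the Willmore energy `W = ∫ H²`,
`hgood` the goodness of the points of `G` up to radius `R₀`. [cite: Allard1972, §6] -/
theorem shadow_injOn_of_good {f νf : M → EuclideanSpace ℝ (Fin 6)}
    (hf : (euclideanMetric (EuclideanSpace ℝ (Fin 6))).IsSpacelikeImmersion (𝓡 4) f)
    (hemb : Manifold.IsSmoothEmbedding (𝓡 4) (𝓡 6) ∞ f)
    (hν : ContMDiff (𝓡 4) 𝓘(ℝ, EuclideanSpace ℝ (Fin 6)) ∞ νf)
    (hun : (euclideanMetric (EuclideanSpace ℝ (Fin 6))).IsUnitNormal (𝓡 4) f νf 1)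
    (hN : ∀ x, ∑ i : Fin 5, f x (Fin.castSucc i) ^ 2 = 1)
    (hνN : ∀ x, ∑ i : Fin 5, νf x (Fin.castSucc i) * f x (Fin.castSucc i) = 0)
    {δ₀ τmax R₀ CA CG Atot W₀ gmax ξ θ c₁ c₂ η Λ₁ C₀sq Kρ κ : ℝ}
    (hδ₀ : 0 < δ₀) (hδ₁ : δ₀ ≤ 1) (hR₀ : 0 < R₀) (hCA : 0 ≤ CA) (hξ : 0 < ξ) (hθ : 0 < θ)
    (hη : 0 < η) (hC₀sq : 0 < C₀sq) (hKρ : 0 < Kρ) (hκ : 0 < κ)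
    (hcut : ∀ a g : ℝ, 0 < g → ∃ u : ℝ → ℝ, ContDiff ℝ 2 u ∧ (∀ t, 0 ≤ u t ∧ u t ≤ 1) ∧
      (∀ t, |deriv u t| ≤ c₁ / g) ∧ (∀ t, |deriv (deriv u) t| ≤ c₂ / g ^ 2) ∧
      (∀ t, t ≤ a - g / 3 → u t = 1) ∧ (∀ t, a ≤ t → u t = 0))
    (hAhl : ∀ y : EuclideanSpace ℝ (Fin 6), ∑ i : Fin 5, y (Fin.castSucc i) ^ 2 = 1 →
      ∀ r, 0 < r → r ≤ R₀ →
        (riemannianMeasure ((euclideanMetric (EuclideanSpace ℝ (Fin 6))).inducedRiemannianMetric f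
          contMDiff_pullbackBilin_holds hf)).real (f ⁻¹' Metric.closedBall y r) ≤ CA * r ^ 4)
    (hAtot : (riemannianMeasure ((euclideanMetric (EuclideanSpace ℝ (Fin 6))).inducedRiemannianMetric f
          contMDiff_pullbackBilin_holds hf)).real univ ≤ Atot)
    (hCG : 2048 * Real.exp (1 / 16) * CA / Real.pi ^ 2 + Atot / R₀ ^ 4 ≤ CG)
    (hWW : ∫ w, (euclideanMetric (EuclideanSpace ℝ (Fin 6))).meanCurvature f contMDiff_pullbackBilin_holds
          hf νf w ^ 2
        ∂riemannianMeasure ((euclideanMetric (EuclideanSpace ℝ (Fin 6))).inducedRiemannianMetric f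
          contMDiff_pullbackBilin_holds hf) ≤ W₀)
    (hup : ∀ p : EuclideanSpace ℝ (Fin 6), ∑ i : Fin 5, p (Fin.castSucc i) ^ 2 = 1 →
      ∀ τ, 0 < τ → τ ≤ τmax →
        ∫ w, Real.exp (-‖f w - p‖ ^ 2 / (4 * τ)) / (4 * Real.pi * τ) ^ 2
          ∂riemannianMeasure ((euclideanMetric (EuclideanSpace ℝ (Fin 6))).inducedRiemannianMetric f
            contMDiff_pullbackBilin_holds hf) ≤ 2 - δ₀)
    (hgap : ∀ x x' : M, f x' 5 - f x 5 ≤ gmax)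
    (hpar : ∀ g W : ℝ, 0 < g → g ≤ gmax → 0 ≤ W → W ≤ W₀ →
        g ^ 2 / C₀sq ≤ Λ₁ * g ^ 2 ∧ Kρ * g ≤ R₀ ∧ (1 + η) * (Λ₁ * g ^ 2) ≤ τmax ∧
        (1 - δ₀ / 8 ≤ (1 + η)⁻¹ ^ 2 *
          Real.exp (-((1 + η⁻¹) * (g / 2) ^ 2) / (4 * ((1 + η) * (Λ₁ * g ^ 2))))) ∧
        (1 - δ₀ / 16 ≤ Real.exp (-(4 * (Λ₁ * g ^ 2)))) ∧
        (Real.exp (4 * (g ^ 2 / C₀sq)) *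
            ((2048 * Real.exp (1 / 16) * (θ * CA) / Real.pi ^ 2 + W / R₀ ^ 4) / 4) * (g ^ 2 / C₀sq) +
          4 * Real.exp (4 * (g ^ 2 / C₀sq)) * Real.exp (-g ^ 2 / (72 * (g ^ 2 / C₀sq))) * CG ≤ δ₀ / 16) ∧
        (((2048 * Real.exp (1 / 16) * (θ * CA) / Real.pi ^ 2 + W / R₀ ^ 4) / 4
          + c₂ / g ^ 2 *
            ((1 / (4 * Real.pi * (g ^ 2 / C₀sq)) ^ 2) * (ξ * (CA * (Kρ * g) ^ 4)) +
              4 * Real.exp (-(Kρ * g) ^ 2 / (8 * (Λ₁ * g ^ 2))) * CG)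
          + c₁ / g *
            ((1 / 2) * (2048 * Real.exp (1 / 16) * (θ * CA) / Real.pi ^ 2 + W / R₀ ^ 4) + (1 / (2 * 1)) * CG)
          + (1 / (g ^ 2 / C₀sq)) * (c₁ / g *
            ((1 / (4 * Real.pi * (g ^ 2 / C₀sq)) ^ 2) * (Kρ * g) *
                ((κ / 2) * (ξ * (CA * (Kρ * g) ^ 4)) + CA * (Kρ * g) ^ 4 / (2 * κ))
              + 32 * Real.sqrt (Λ₁ * g ^ 2) * Real.exp (-(1 / 2)) *
                Real.exp (-(Kρ * g) ^ 2 / (16 * (Λ₁ * g ^ 2))) * CG)))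
          * (Λ₁ * g ^ 2) ≤ δ₀ / 16))
    {G : Set M}
    (hgood : ∀ y ∈ G, ∀ r, 0 < r → r ≤ R₀ →
      (∫ w in f ⁻¹' Metric.closedBall (f y) r, (∑ i : Fin 5, νf w (Fin.castSucc i) ^ 2)
          ∂riemannianMeasure ((euclideanMetric (EuclideanSpace ℝ (Fin 6))).inducedRiemannianMetric f
            contMDiff_pullbackBilin_holds hf) ≤
        ξ * (riemannianMeasure ((euclideanMetric (EuclideanSpace ℝ (Fin 6))).inducedRiemannianMetric f
          contMDiff_pullbackBilin_holds hf)).real (f ⁻¹' Metric.closedBall (f y) r)) ∧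
      (∫ w in f ⁻¹' Metric.closedBall (f y) r,
          (euclideanMetric (EuclideanSpace ℝ (Fin 6))).meanCurvature f contMDiff_pullbackBilin_holds
            hf νf w ^ 2
          ∂riemannianMeasure ((euclideanMetric (EuclideanSpace ℝ (Fin 6))).inducedRiemannianMetric f
            contMDiff_pullbackBilin_holds hf) ≤
        θ * (riemannianMeasure ((euclideanMetric (EuclideanSpace ℝ (Fin 6))).inducedRiemannianMetric f
          contMDiff_pullbackBilin_holds hf)).real (f ⁻¹' Metric.closedBall (f y) r))) :
    InjOn (fun x => truncL (f x)) G := by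
  -- the Willmore energy
  set W : ℝ := ∫ w, (euclideanMetric (EuclideanSpace ℝ (Fin 6))).meanCurvature f
    contMDiff_pullbackBilin_holds hf νf w ^ 2
    ∂riemannianMeasure ((euclideanMetric (EuclideanSpace ℝ (Fin 6))).inducedRiemannianMetric f
      contMDiff_pullbackBilin_holds hf) with hWdef
  have hW0 : 0 ≤ W := integral_nonneg fun w => sq_nonneg _
  have hinjf : Injective f := hemb.isEmbedding.injective
  -- the core: a lower and an upper good point on one vertical are impossible
  have core : ∀ y y' : M, y ∈ G → y' ∈ G → (∀ i : Fin 5, f y (Fin.castSucc i) = f y' (Fin.castSucc i)) →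
      f y 5 < f y' 5 → False := by
    intro y y' hy hy' hsh hlt
    set g : ℝ := f y' 5 - f y 5 with hg
    have hg0 : 0 < g := by rw [hg]; linarith
    have hgle : g ≤ gmax := hgap y y'
    obtain ⟨h1, h2, h3, h4, h5, h6, h7⟩ := hpar g W hg0 hgle hW0 hWW
    refine noTwoGoodPoints hf hemb hν hun hN hνN hδ₀ hδ₁ hR₀ hCA hξ hθ.le
      (σ₀ := g ^ 2 / C₀sq) (σ₁ := Λ₁ * g ^ 2) (ρ := Kρ * g) (by positivity) h1 (by positivity) h2 hη hκ
      h3 hcut hAhl hAtot hCG le_rfl hup y y' hsh hlt ?_ h4 h5 h6 h7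
    intro z hz r hr hrR
    simp only [Set.mem_insert_iff, Set.mem_singleton_iff] at hz
    rcases hz with rfl | rfl
    · exact hgood _ hy r hr hrR
    · exact hgood _ hy' r hr hrR
  -- injectivity
  intro y₁ hy₁ y₂ hy₂ heq
  by_contra hne
  have hsh : ∀ i : Fin 5, f y₁ (Fin.castSucc i) = f y₂ (Fin.castSucc i) := fun i => by
    have := congrArg (fun v => v i) heq
    simpa [truncL_apply] using this
  have h5 : f y₁ 5 ≠ f y₂ 5 := fun h5 =>
    hne (hinjf (eq_of_truncL_eq_of_apply_five_eq' heq h5))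
  rcases lt_or_gt_of_ne h5 with hlt | hgt
  · exact core y₁ y₂ hy₁ hy₂ hsh hlt
  · exact core y₂ y₁ hy₂ hy₁ (fun i => (hsh i).symm) hgt

end Summit.SmoothPoincare4.SmoothPoincare4.Cruxes.CylinderRungTwo.KillingFlux

end
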